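import Summits.ResolutionOfSingularities.ResolutionOfSingularities.Theorems.EquisingularLiftEquisingularLiftNatPlaneChartsAwayMk
import Mathlib.Tactic.LinearCombination
import HarnessLib

/-!
# [OURS · L1 W4.5(b) · EL♮(3) · NEST host kit, part 3] THE GENERIC PLANE-CURVE TWISTED SPLITTING
# (`Ȟ¹(C, 𝒪_C(d)) = 0` for EVERY plane curve `C = V₊(F) ⊂ ℙ²_R`, in the two-chart cochain currency of D3-7)

Crux chain w45b (cell `res-hironaka`, LADDER-RESOLUTION rung L, slot W4.5(b)), child EL♮(3) = stmt-ResolutionOfSingularities-20148;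
WIDTH TABLE D3 «NEST» (desk RULING R39 (i): the NEST round's `DirStepUnobs` clause is «certified per specimen … Čech style»; D3-7 =
res-L1-w45b-nose-w1's PRODUCER ✓ `Sections.dirStepUnobs_univ_of_charts` (…NatDirStepUnobsOfCharts), whose one cohomological input is the twisted
splitting `hsplit`; D3-10 / (U-plane) = this seat's host kit ✓ `…NatDirStepUnobsHostChange`, ✓ `…NatFreshPlaneProj`: every fresh plane is a `ℙ²_R`).
This file supplies `hsplit` ON `ℙ²_R` FOR EVERY PLANE CURVE AT ONCE, at the ring level.  res-L1-w45b-iso-w2 g2 (WIDTH seat D-0157 DOOR 1),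
`--supports stmt-ResolutionOfSingularities-20148 --as helper`.  OURS; NOT a statement of any manuscript; AI-written, weaker than expert review.
No `sorry`; standard axioms; DEF-FREE (the splitting predicate is spelled inline).

THE STATEMENT (`planeCurve_twisted_split`).  `R` any commutative ring, `F ∈ R[X₀,X₁,X₂]` homogeneous of degree `d` with `X₀^d`-coefficient a
UNIT (⇔ `(1:0:0) ∉ V₊(F)` — the two charts `D₊(X₁)`, `D₊(X₂)` then cover the curve; over an infinite field always arrangeable by a linear change of
coordinates).  Then every `c ∈ (R[X]_{X₁X₂})₀` is `ι₁ v₁ + (X₂/X₁)^d · ι₂ v₂ + w · (F/X₁^d)` with `v₁ ∈ (R[X]_{X₁})₀`, `v₂ ∈ (R[X]_{X₂})₀`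
(`ι₁`, `ι₂` = Mathlib `HomogeneousLocalization.awayMap`; `X₂/X₁ = X₂²/(X₁X₂)`, `F/X₁^d = F X₂^d/(X₁X₂)^d` as `Away.mk` fractions).  Read on the
curve (`mod F`) this is `Ȟ¹((D₊(X₁) ∩ C, D₊(X₂) ∩ C); 𝒪_C(d)) = 0` in the trivialisations `X₁^d`, `X₂^d` — i.e. exactly D3-7's `hsplit` for
`G := ℙ²_R`, generators `F/X₁^d`, `F/X₂^d`, transition `M = (X₂/X₁)^d` — with NO hypothesis on `F` beyond the unit coefficient (no smoothness,
irreducibility or reducedness: Hartshorne III 5.1's `H¹(ℙ², 𝒪(n)) = 0`, `H²(ℙ², 𝒪) = 0` is the reason, the proof below is the explicit cochain).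
PROOF.  `(R[X]_{X₁X₂})₀` is spanned by the monomial fractions `C r X₀ⁱX₁ʲX₂ˡ/(X₁X₂)^m`, `i + j + l = 2m`; strong induction on `i`:
`i ≥ d` — reduce with `u X₀^d = F − F'` where `F' = F − u X₀^d` has `X₀`-degree `< d` (the `F`-multiple is `w·(F/X₁^d)`, `split_caseF`);
`i < d` — if `l ≥ m` the fraction comes from `D₊(X₁)` (`split_caseA`), else `l < m` forces `j + d > m` and it is `(X₂/X₁)^d` times a fraction
from `D₊(X₂)` (`split_caseB`).  Small print on `Away.mk` (`away_mk_eq_mk/_add/_mul/_pow/_zero/_neg`) is proved here, generically.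

CUSTOMERS.  D3-8 (the S10 conic, `d = 2`), lines (`d = 1`), every (β) post-carrier NEST centre lying in a fresh plane; with ✓
`Sections.dirStepUnobs_freshPlane_of_forall_model` + D3-7 the remaining per-curve inputs are the scheme-level reading of this identity on `ℙ²_R`
(Mathlib `Proj.awayToSection` / `awayMap_awayToSection`) and the curve-specific `hI` (the two dehomogenisations of `F` generate the vanishing ideal
of the CURVE SET — radicality) and quasi-regularity (`F/Xᵢ^d` a non-zero-divisor).  HONEST SCOPE: ring-level identity only; counted 0; EL♮(3) is NOT
proved; resolution in characteristic `p` is NOT proved here (dim 3 is Cossart–Piltant 2008/2009 in print).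

References (index only): R. Hartshorne, *Algebraic Geometry* (1977), III Thm. 5.1 and its proof (Čech complex of `𝒪(n)` on the standard
cover) [cite: Hartshorne1977]; J. Lipman, Publ. Math. IHÉS 36 (1969), proof of Prop. (1.2) (the Laurent splitting) [cite: Lipman1969].
-/

set_option linter.dupNamespace false -- mandated namespace `Summit.<Summit>.<Problem>` of this single-conjunct summit

noncomputable section

open MvPolynomial HomogeneousLocalization

attribute [local instance] MvPolynomial.gradedAlgebra

namespace Summit.ResolutionOfSingularities.ResolutionOfSingularities.Cruxes.EquisingularLiftNat.Sections

namespace PlaneCurveSplit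

universe u

section Plane

variable {R : Type u} [CommRing R]

/-! ### The splitting predicate and its closure properties

`c ∈ (R[X]_{X₁X₂})₀` SPLITS (for the curve `F` of degree `d`) when `c = ι₁ v₁ + T^d · ι₂ v₂ + w · (F/X₁^d)` with `v₁ ∈ (R[X]_{X₁})₀`,
`v₂ ∈ (R[X]_{X₂})₀`, `ι₁`, `ι₂` the canonical maps (Mathlib `awayMap`), `T = X₂²/(X₁X₂) = X₂/X₁` the transition function and
`F/X₁^d = F X₂^d/(X₁X₂)^d`.  (Definition-free: the predicate is spelled inline in every statement.) -/

section Split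

variable {d : ℕ} {F : MvPolynomial (Fin 3) R} (hF : F.IsHomogeneous d)

/-- Splittings add. [OURS · bookkeeping] -/
theorem split_add {c c' : Away (homogeneousSubmodule (Fin 3) R) (X 1 * X 2 : MvPolynomial (Fin 3) R)}
    (hc : ∃ v₁ v₂ w, c = awayMap (homogeneousSubmodule (Fin 3) R) (X_two_mem R) (x := X 1 * X 2) rfl v₁ +
      Away.mk _ (X_one_mul_X_two_mem R) 1 (X 2 * X 2) (X_two_sq_mem R) ^ d *
        awayMap (homogeneousSubmodule (Fin 3) R) (X_one_mem R) (x := X 1 * X 2) (mul_comm _ _) v₂ +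
      w * Away.mk _ (X_one_mul_X_two_mem R) d (F * X 2 ^ d) (mul_X_two_pow_mem hF))
    (hc' : ∃ v₁ v₂ w, c' = awayMap (homogeneousSubmodule (Fin 3) R) (X_two_mem R) (x := X 1 * X 2) rfl v₁ +
      Away.mk _ (X_one_mul_X_two_mem R) 1 (X 2 * X 2) (X_two_sq_mem R) ^ d *
        awayMap (homogeneousSubmodule (Fin 3) R) (X_one_mem R) (x := X 1 * X 2) (mul_comm _ _) v₂ +
      w * Away.mk _ (X_one_mul_X_two_mem R) d (F * X 2 ^ d) (mul_X_two_pow_mem hF)) :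
    ∃ v₁ v₂ w, c + c' = awayMap (homogeneousSubmodule (Fin 3) R) (X_two_mem R) (x := X 1 * X 2) rfl v₁ +
      Away.mk _ (X_one_mul_X_two_mem R) 1 (X 2 * X 2) (X_two_sq_mem R) ^ d *
        awayMap (homogeneousSubmodule (Fin 3) R) (X_one_mem R) (x := X 1 * X 2) (mul_comm _ _) v₂ +
      w * Away.mk _ (X_one_mul_X_two_mem R) d (F * X 2 ^ d) (mul_X_two_pow_mem hF) := by
  obtain ⟨v₁, v₂, w, rfl⟩ := hc
  obtain ⟨v₁', v₂', w', rfl⟩ := hc'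
  exact ⟨v₁ + v₁', v₂ + v₂', w + w', by rw [map_add, map_add]; ring⟩

/-- Splittings negate. [OURS · bookkeeping] -/
theorem split_neg {c : Away (homogeneousSubmodule (Fin 3) R) (X 1 * X 2 : MvPolynomial (Fin 3) R)}
    (hc : ∃ v₁ v₂ w, c = awayMap (homogeneousSubmodule (Fin 3) R) (X_two_mem R) (x := X 1 * X 2) rfl v₁ +
      Away.mk _ (X_one_mul_X_two_mem R) 1 (X 2 * X 2) (X_two_sq_mem R) ^ d *
        awayMap (homogeneousSubmodule (Fin 3) R) (X_one_mem R) (x := X 1 * X 2) (mul_comm _ _) v₂ +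
      w * Away.mk _ (X_one_mul_X_two_mem R) d (F * X 2 ^ d) (mul_X_two_pow_mem hF)) :
    ∃ v₁ v₂ w, -c = awayMap (homogeneousSubmodule (Fin 3) R) (X_two_mem R) (x := X 1 * X 2) rfl v₁ +
      Away.mk _ (X_one_mul_X_two_mem R) 1 (X 2 * X 2) (X_two_sq_mem R) ^ d *
        awayMap (homogeneousSubmodule (Fin 3) R) (X_one_mem R) (x := X 1 * X 2) (mul_comm _ _) v₂ +
      w * Away.mk _ (X_one_mul_X_two_mem R) d (F * X 2 ^ d) (mul_X_two_pow_mem hF) := by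
  obtain ⟨v₁, v₂, w, rfl⟩ := hc
  exact ⟨-v₁, -v₂, -w, by rw [map_neg, map_neg]; ring⟩

/-- The zero function splits. [OURS · bookkeeping] -/
theorem split_zero :
    ∃ v₁ v₂ w, (0 : Away (homogeneousSubmodule (Fin 3) R) (X 1 * X 2 : MvPolynomial (Fin 3) R)) =
      awayMap (homogeneousSubmodule (Fin 3) R) (X_two_mem R) (x := X 1 * X 2) rfl v₁ +
      Away.mk _ (X_one_mul_X_two_mem R) 1 (X 2 * X 2) (X_two_sq_mem R) ^ d *
        awayMap (homogeneousSubmodule (Fin 3) R) (X_one_mem R) (x := X 1 * X 2) (mul_comm _ _) v₂ +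
      w * Away.mk _ (X_one_mul_X_two_mem R) d (F * X 2 ^ d) (mul_X_two_pow_mem hF) :=
  ⟨0, 0, 0, by rw [map_zero, map_zero]; ring⟩

/-- A finite sum of fractions with splitting numerators splits. [OURS · bookkeeping] -/
theorem split_sum {m : ℕ} {T : Type*} (s : Finset T) (a : T → MvPolynomial (Fin 3) R)
    (ha : ∀ t ∈ s, a t ∈ homogeneousSubmodule (Fin 3) R (m • 2))
    (hs : ∀ t (ht : t ∈ s), ∃ v₁ v₂ w, Away.mk _ (X_one_mul_X_two_mem R) m (a t) (ha t ht) =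
      awayMap (homogeneousSubmodule (Fin 3) R) (X_two_mem R) (x := X 1 * X 2) rfl v₁ +
      Away.mk _ (X_one_mul_X_two_mem R) 1 (X 2 * X 2) (X_two_sq_mem R) ^ d *
        awayMap (homogeneousSubmodule (Fin 3) R) (X_one_mem R) (x := X 1 * X 2) (mul_comm _ _) v₂ +
      w * Away.mk _ (X_one_mul_X_two_mem R) d (F * X 2 ^ d) (mul_X_two_pow_mem hF)) :
    ∃ v₁ v₂ w, Away.mk _ (X_one_mul_X_two_mem R) m (∑ t ∈ s, a t) (Submodule.sum_mem _ ha) =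
      awayMap (homogeneousSubmodule (Fin 3) R) (X_two_mem R) (x := X 1 * X 2) rfl v₁ +
      Away.mk _ (X_one_mul_X_two_mem R) 1 (X 2 * X 2) (X_two_sq_mem R) ^ d *
        awayMap (homogeneousSubmodule (Fin 3) R) (X_one_mem R) (x := X 1 * X 2) (mul_comm _ _) v₂ +
      w * Away.mk _ (X_one_mul_X_two_mem R) d (F * X 2 ^ d) (mul_X_two_pow_mem hF) := by
  classical
  induction s using Finset.induction_on with
  | empty =>
    have h0 : Away.mk _ (X_one_mul_X_two_mem R) m (∑ t ∈ (∅ : Finset T), a t) (Submodule.sum_mem _ ha) = 0 := by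
      rw [← away_mk_zero (homogeneousSubmodule (Fin 3) R) (X_one_mul_X_two_mem R) m]
      exact away_mk_eq_mk _ _ _ _ _ (by rw [Finset.sum_empty])
    rw [h0]; exact split_zero hF
  | insert t s hts ih =>
    have hsplit : Away.mk _ (X_one_mul_X_two_mem R) m (∑ t ∈ insert t s, a t) (Submodule.sum_mem _ ha) =
        Away.mk _ (X_one_mul_X_two_mem R) m (a t) (ha t (Finset.mem_insert_self t s)) +
          Away.mk _ (X_one_mul_X_two_mem R) m (∑ t ∈ s, a t)
            (Submodule.sum_mem _ fun t' ht' => ha t' (Finset.mem_insert_of_mem ht')) := by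
      rw [away_mk_add]
      exact away_mk_eq_mk _ _ _ _ _ (by rw [Finset.sum_insert hts])
    rw [hsplit]
    exact split_add hF (hs t (Finset.mem_insert_self t s))
      (ih (fun t' ht' => ha t' (Finset.mem_insert_of_mem ht')) (fun t' ht' => hs t' (Finset.mem_insert_of_mem ht')))


/-! ### The three generators of the splitting -/

/-- **Case (a): `X₂`-exponent `≥ m`** — the monomial fraction comes from the chart `D₊(X₁)`:
`C r X₀ⁱ X₁ʲ X₂^{m+t}/(X₁X₂)^m = ι₁ (C r X₀ⁱ X₁ʲ X₂ᵗ / X₁^m)`. [OURS · L1 W4.5b] -/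
theorem split_caseA {i j t m : ℕ} (hm : i + j + t = m) (r : R) :
    ∃ v₁ v₂ w, Away.mk _ (X_one_mul_X_two_mem R) m (C r * X 0 ^ i * X 1 ^ j * X 2 ^ (m + t))
        (monomial_mem (by omega) r) =
      awayMap (homogeneousSubmodule (Fin 3) R) (X_two_mem R) (x := X 1 * X 2) rfl v₁ +
      Away.mk _ (X_one_mul_X_two_mem R) 1 (X 2 * X 2) (X_two_sq_mem R) ^ d *
        awayMap (homogeneousSubmodule (Fin 3) R) (X_one_mem R) (x := X 1 * X 2) (mul_comm _ _) v₂ +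
      w * Away.mk _ (X_one_mul_X_two_mem R) d (F * X 2 ^ d) (mul_X_two_pow_mem hF) := by
  have hv : (C r * X 0 ^ i * X 1 ^ j * X 2 ^ t : MvPolynomial (Fin 3) R) ∈ homogeneousSubmodule (Fin 3) R (m • 1) := by
    rw [mem_homogeneousSubmodule, smul_eq_mul, mul_one, ← hm]
    exact isHomogeneous_C_mul_monomial r i j t
  refine ⟨Away.mk _ (X_one_mem R) m _ hv, 0, 0, ?_⟩
  rw [map_zero, mul_zero, zero_mul, add_zero, add_zero, awayMap_mk]
  exact away_mk_eq_mk _ _ _ _ _ (by ring)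

/-- **Case (b): `X₂`-exponent `< m`, `X₁`-exponent `+ d ≥ m`** — the monomial fraction is `T^d` times a function from the chart `D₊(X₂)`:
with `m = l + t + 1`, `j + d = m + s`: `C r X₀ⁱ X₁ʲ X₂ˡ/(X₁X₂)^m = (X₂/X₁)^d · ι₂ (C r X₀ⁱ X₁ˢ / X₂^{d+t+1})`. [OURS · L1 W4.5b] -/
theorem split_caseB {i j l m t s : ℕ} (h : i + j + l = 2 * m) (hm : m = l + t + 1) (hjs : j + d = m + s) (r : R) :
    ∃ v₁ v₂ w, Away.mk _ (X_one_mul_X_two_mem R) m (C r * X 0 ^ i * X 1 ^ j * X 2 ^ l) (monomial_mem h r) =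
      awayMap (homogeneousSubmodule (Fin 3) R) (X_two_mem R) (x := X 1 * X 2) rfl v₁ +
      Away.mk _ (X_one_mul_X_two_mem R) 1 (X 2 * X 2) (X_two_sq_mem R) ^ d *
        awayMap (homogeneousSubmodule (Fin 3) R) (X_one_mem R) (x := X 1 * X 2) (mul_comm _ _) v₂ +
      w * Away.mk _ (X_one_mul_X_two_mem R) d (F * X 2 ^ d) (mul_X_two_pow_mem hF) := by
  have hv : (C r * X 0 ^ i * X 1 ^ s : MvPolynomial (Fin 3) R) ∈ homogeneousSubmodule (Fin 3) R ((d + t + 1) • 1) := by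
    rw [mem_homogeneousSubmodule, smul_eq_mul, mul_one, show d + t + 1 = i + s + 0 by omega]
    simpa using isHomogeneous_C_mul_monomial r i s 0
  refine ⟨0, Away.mk _ (X_two_mem R) (d + t + 1) _ hv, 0, ?_⟩
  rw [map_zero, zero_mul, zero_add, add_zero, awayMap_mk, away_mk_pow]
  -- bring the second factor to the denominator bookkeeping `(X_one_mul_X_two_mem R)`, then multiply
  have e2 : Away.mk (homogeneousSubmodule (Fin 3) R) ((mul_comm (X 1) (X 2) : (X 1 * X 2 : MvPolynomial (Fin 3) R) = X 2 * X 1) ▸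
        SetLike.mul_mem_graded (X_two_mem R) (X_one_mem R)) (d + t + 1)
        (C r * X 0 ^ i * X 1 ^ s * X 1 ^ (d + t + 1))
        (by rw [smul_add]; exact SetLike.mul_mem_graded hv (SetLike.pow_mem_graded (d + t + 1) (X_one_mem R))) =
      Away.mk _ (X_one_mul_X_two_mem R) (d + t + 1) (C r * X 0 ^ i * X 1 ^ s * X 1 ^ (d + t + 1))
        (by
          rw [mem_homogeneousSubmodule, smul_eq_mul, show (d + t + 1) * 2 = i + (s + (d + t + 1)) + 0 by omega,
            show (C r * X 0 ^ i * X 1 ^ s * X 1 ^ (d + t + 1) : MvPolynomial (Fin 3) R) =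
              C r * X 0 ^ i * X 1 ^ (s + (d + t + 1)) * X 2 ^ 0 by ring]
          exact isHomogeneous_C_mul_monomial r i (s + (d + t + 1)) 0) :=
    away_mk_eq_mk _ _ _ _ _ rfl
  rw [e2, away_mk_mul]
  refine away_mk_eq_mk _ _ _ _ _ ?_
  have eL : ((X 2 * X 2) ^ d * (C r * X 0 ^ i * X 1 ^ s * X 1 ^ (d + t + 1)) : MvPolynomial (Fin 3) R) * (X 1 * X 2) ^ m =
      C r * X 0 ^ i * X 1 ^ (s + (d + t + 1) + m) * X 2 ^ (2 * d + m) := by ring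
  have eR : (C r * X 0 ^ i * X 1 ^ j * X 2 ^ l : MvPolynomial (Fin 3) R) * (X 1 * X 2) ^ (d * 1 + (d + t + 1)) =
      C r * X 0 ^ i * X 1 ^ (j + d + (d + t + 1)) * X 2 ^ (l + d + (d + t + 1)) := by ring
  rw [eL, eR, show j + d + (d + t + 1) = s + (d + t + 1) + m by omega, show l + d + (d + t + 1) = 2 * d + m by omega]

/-- **The `F`-multiples split**: `(C r X₀ⁱ X₁ʲ X₂ˡ · F)/(X₁X₂)^m = w · (F/X₁^d)` with `w = C r X₀ⁱ X₁^{j+d} X₂ˡ/(X₁X₂)^m`. [OURS · L1 W4.5b] -/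
theorem split_caseF {i j l m : ℕ} (h : i + j + l + d = 2 * m) (r : R) :
    ∃ v₁ v₂ w, Away.mk _ (X_one_mul_X_two_mem R) m (C r * X 0 ^ i * X 1 ^ j * X 2 ^ l * F)
        (by
          rw [mem_homogeneousSubmodule, smul_eq_mul, show m * 2 = i + j + l + d by omega]
          exact (isHomogeneous_C_mul_monomial r i j l).mul hF) =
      awayMap (homogeneousSubmodule (Fin 3) R) (X_two_mem R) (x := X 1 * X 2) rfl v₁ +
      Away.mk _ (X_one_mul_X_two_mem R) 1 (X 2 * X 2) (X_two_sq_mem R) ^ d *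
        awayMap (homogeneousSubmodule (Fin 3) R) (X_one_mem R) (x := X 1 * X 2) (mul_comm _ _) v₂ +
      w * Away.mk _ (X_one_mul_X_two_mem R) d (F * X 2 ^ d) (mul_X_two_pow_mem hF) := by
  refine ⟨0, 0, Away.mk _ (X_one_mul_X_two_mem R) m (C r * X 0 ^ i * X 1 ^ (j + d) * X 2 ^ l) (monomial_mem (by omega) r), ?_⟩
  rw [map_zero, map_zero, mul_zero, zero_add, zero_add, away_mk_mul]
  exact away_mk_eq_mk _ _ _ _ _ (by ring)


/-! ### Every monomial fraction splits (strong induction on the `X₀`-exponent), hence every function on `D₊(X₁X₂)` -/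

/-- **Every monomial fraction `C r X₀ⁱ X₁ʲ X₂ˡ/(X₁X₂)^m` splits**, provided the `X₀^d`-coefficient of `F` is a unit (the point `(1:0:0)` is off the
curve).  Strong induction on `i`: for `i ≥ d` reduce with `u X₀^d = F − F'` (`F'` has `X₀`-degree `< d`; the `F`-multiple splits by
`split_caseF`); for `i < d` one of the cases (a) (`l ≥ m`) / (b) (`l < m`, then `j + d > m`) applies. [OURS · L1 W4.5b] -/
theorem split_monomial (hu : IsUnit (coeff (Finsupp.single 0 d) F)) :
    ∀ (i j l m : ℕ) (r : R) (h : i + j + l = 2 * m),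
      ∃ v₁ v₂ w, Away.mk _ (X_one_mul_X_two_mem R) m (C r * X 0 ^ i * X 1 ^ j * X 2 ^ l) (monomial_mem h r) =
        awayMap (homogeneousSubmodule (Fin 3) R) (X_two_mem R) (x := X 1 * X 2) rfl v₁ +
        Away.mk _ (X_one_mul_X_two_mem R) 1 (X 2 * X 2) (X_two_sq_mem R) ^ d *
          awayMap (homogeneousSubmodule (Fin 3) R) (X_one_mem R) (x := X 1 * X 2) (mul_comm _ _) v₂ +
        w * Away.mk _ (X_one_mul_X_two_mem R) d (F * X 2 ^ d) (mul_X_two_pow_mem hF) := by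
  classical
  obtain ⟨u, hu⟩ := hu
  -- `F' := F − u X₀^d` is homogeneous of degree `d` with `X₀`-degree `< d`
  set F' : MvPolynomial (Fin 3) R := F - C (u : R) * X 0 ^ d with hF'def
  have hF' : F'.IsHomogeneous d := by
    have h1 : (C (u : R) * X 0 ^ d : MvPolynomial (Fin 3) R).IsHomogeneous d := by
      simpa using (isHomogeneous_C (Fin 3) (u : R)).mul ((isHomogeneous_X R (0 : Fin 3)).pow d)
    exact hF.sub h1
  have hF'supp : ∀ s ∈ F'.support, s 0 < d := by
    intro s hs
    by_contra hlt
    have hdeg := support_degree_eq hF' s hs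
    have hs0 : s 0 = d := by omega
    have hs1 : s 1 = 0 := by omega
    have hs2 : s 2 = 0 := by omega
    have hseq : s = Finsupp.single 0 d := by
      ext k
      fin_cases k
      · simpa using hs0
      · simpa using hs1
      · simpa using hs2
    rw [mem_support_iff, hseq, hF'def, coeff_sub, coeff_C_mul, coeff_X_pow, if_pos rfl, ← hu, mul_one, sub_self] at hs
    exact hs rfl
  have hPu : (C ((↑u⁻¹ : Rˣ) : R) * C (u : R) : MvPolynomial (Fin 3) R) = 1 := by
    rw [← map_mul, Units.inv_mul, map_one]
  have hFF' : F - F' = C (u : R) * X 0 ^ d := by rw [hF'def, sub_sub_cancel]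
  intro i
  induction i using Nat.strong_induction_on with
  | _ i ih =>
    intro j l m r h
    by_cases hdi : d ≤ i
    · -- reduction: `i = d + i'`, `C r X₀^{d+i'} X₁ʲ X₂ˡ = P' F − P' F'` with `P' = C r C u⁻¹ X₀^{i'} X₁ʲ X₂ˡ`
      obtain ⟨i', rfl⟩ := Nat.exists_eq_add_of_le hdi
      have hPF : (C (r * ((↑u⁻¹ : Rˣ) : R)) * X 0 ^ i' * X 1 ^ j * X 2 ^ l * F : MvPolynomial (Fin 3) R) ∈
          homogeneousSubmodule (Fin 3) R (m • 2) := by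
        rw [mem_homogeneousSubmodule, smul_eq_mul, show m * 2 = i' + j + l + d by omega]
        exact (isHomogeneous_C_mul_monomial _ i' j l).mul hF
      have hPF' : (C (r * ((↑u⁻¹ : Rˣ) : R)) * X 0 ^ i' * X 1 ^ j * X 2 ^ l * F' : MvPolynomial (Fin 3) R) ∈
          homogeneousSubmodule (Fin 3) R (m • 2) := by
        rw [mem_homogeneousSubmodule, smul_eq_mul, show m * 2 = i' + j + l + d by omega]
        exact (isHomogeneous_C_mul_monomial _ i' j l).mul hF'
      have hnum : (C r * X 0 ^ (d + i') * X 1 ^ j * X 2 ^ l : MvPolynomial (Fin 3) R) =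
          C (r * ((↑u⁻¹ : Rˣ) : R)) * X 0 ^ i' * X 1 ^ j * X 2 ^ l * F +
            -(C (r * ((↑u⁻¹ : Rˣ) : R)) * X 0 ^ i' * X 1 ^ j * X 2 ^ l * F') := by
        rw [← sub_eq_add_neg, ← mul_sub, hFF', map_mul]
        linear_combination (-(C r * X 0 ^ i' * X 1 ^ j * X 2 ^ l * X 0 ^ d : MvPolynomial (Fin 3) R)) * hPu
      have e : Away.mk _ (X_one_mul_X_two_mem R) m (C r * X 0 ^ (d + i') * X 1 ^ j * X 2 ^ l) (monomial_mem h r) =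
          Away.mk _ (X_one_mul_X_two_mem R) m _ hPF + Away.mk _ (X_one_mul_X_two_mem R) m _ (neg_mem hPF') := by
        rw [away_mk_add]
        exact away_mk_eq_mk _ _ _ _ _ (by rw [hnum])
      rw [e]
      refine split_add hF (split_caseF hF (by omega) _) ?_
      rw [← away_mk_neg (homogeneousSubmodule (Fin 3) R) (X_one_mul_X_two_mem R) hPF']
      refine split_neg hF ?_
      -- `P' F'` is a sum of monomial fractions with SMALLER `X₀`-exponent
      have ha : ∀ s ∈ F'.support, (C (r * ((↑u⁻¹ : Rˣ) : R)) * X 0 ^ i' * X 1 ^ j * X 2 ^ l * monomial s (coeff s F') :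
          MvPolynomial (Fin 3) R) ∈ homogeneousSubmodule (Fin 3) R (m • 2) := by
        intro s hs
        have hdeg := support_degree_eq hF' s hs
        rw [monomial_eq_C_mul_X_pow, mem_homogeneousSubmodule, smul_eq_mul,
          show (C (r * ((↑u⁻¹ : Rˣ) : R)) * X 0 ^ i' * X 1 ^ j * X 2 ^ l * (C (coeff s F') * X 0 ^ s 0 * X 1 ^ s 1 * X 2 ^ s 2) :
              MvPolynomial (Fin 3) R) =
            C (r * ((↑u⁻¹ : Rˣ) : R)) * C (coeff s F') * X 0 ^ (i' + s 0) * X 1 ^ (j + s 1) * X 2 ^ (l + s 2) by ring,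
          ← map_mul, show m * 2 = (i' + s 0) + (j + s 1) + (l + s 2) by omega]
        exact isHomogeneous_C_mul_monomial _ _ _ _
      have esum : Away.mk _ (X_one_mul_X_two_mem R) m (C (r * ((↑u⁻¹ : Rˣ) : R)) * X 0 ^ i' * X 1 ^ j * X 2 ^ l * F') hPF' =
          Away.mk _ (X_one_mul_X_two_mem R) m (∑ s ∈ F'.support,
            C (r * ((↑u⁻¹ : Rˣ) : R)) * X 0 ^ i' * X 1 ^ j * X 2 ^ l * monomial s (coeff s F')) (Submodule.sum_mem _ ha) :=
        away_mk_eq_mk _ _ _ _ _ (by rw [← Finset.mul_sum, ← F'.as_sum])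
      rw [esum]
      refine split_sum hF F'.support _ ha fun s hs => ?_
      have hdeg := support_degree_eq hF' s hs
      have hlt : i' + s 0 < d + i' := by have := hF'supp s hs; omega
      have e' : Away.mk _ (X_one_mul_X_two_mem R) m
            (C (r * ((↑u⁻¹ : Rˣ) : R)) * X 0 ^ i' * X 1 ^ j * X 2 ^ l * monomial s (coeff s F')) (ha s hs) =
          Away.mk _ (X_one_mul_X_two_mem R) m
            (C (r * ((↑u⁻¹ : Rˣ) : R) * coeff s F') * X 0 ^ (i' + s 0) * X 1 ^ (j + s 1) * X 2 ^ (l + s 2))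
            (monomial_mem (by omega) _) :=
        away_mk_eq_mk _ _ _ _ _ (by rw [monomial_eq_C_mul_X_pow, map_mul, map_mul, map_mul]; ring)
      rw [e']
      exact ih (i' + s 0) hlt (j + s 1) (l + s 2) m _ (by omega)
    · -- `i < d`: case (a) if `l ≥ m`, else case (b)
      by_cases hml : m ≤ l
      · obtain ⟨t, rfl⟩ := Nat.exists_eq_add_of_le hml
        exact split_caseA hF (by omega) r
      · obtain ⟨t, ht⟩ := Nat.exists_eq_add_of_lt (not_le.mp hml)
        have hjd : m ≤ j + d := by omega
        obtain ⟨s, hs⟩ := Nat.exists_eq_add_of_le hjd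
        exact split_caseB hF h (by omega) hs r

/-- **THE GENERIC PLANE-CURVE TWISTED SPLITTING** (= `Ȟ¹(C, 𝒪_C(d)) = 0` in two-chart cochain form).  `R` any commutative ring,
`F ∈ R[X₀,X₁,X₂]` homogeneous of degree `d` whose `X₀^d`-coefficient is a UNIT (⇔ the point `(1:0:0)` is off `V₊(F)`, so the two charts
`D₊(X₁)`, `D₊(X₂)` cover the curve).  Then EVERY `c ∈ (R[X]_{X₁X₂})₀` splits as `c = ι₁ v₁ + (X₂/X₁)^d · ι₂ v₂ + w · (F/X₁^d)` with
`v₁ ∈ (R[X]_{X₁})₀`, `v₂ ∈ (R[X]_{X₂})₀` — the `hsplit` input of ✓ `Sections.dirStepUnobs_univ_of_charts` (…NatDirStepUnobsOfCharts, D3-7) at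
`G := ℙ²_R` with generators `F/X₁^d`, `F/X₂^d` and transition `(X₂/X₁)^d`, for EVERY plane curve at once (no smoothness, no irreducibility,
no reducedness of `F` is used).  [cite: Hartshorne1977, III Thm. 5.1 (the computation it packages: `H¹(ℙ², 𝒪(n)) = 0`, `H²(ℙ², 𝒪) = 0`)]
[OURS · L1 W4.5b · EL♮(3) · NEST host kit part 3; NOT a statement of the manuscript] -/
theorem planeCurve_twisted_split (hu : IsUnit (coeff (Finsupp.single 0 d) F))
    (c : Away (homogeneousSubmodule (Fin 3) R) (X 1 * X 2 : MvPolynomial (Fin 3) R)) :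
    ∃ (v₁ : Away (homogeneousSubmodule (Fin 3) R) (X 1 : MvPolynomial (Fin 3) R))
      (v₂ : Away (homogeneousSubmodule (Fin 3) R) (X 2 : MvPolynomial (Fin 3) R))
      (w : Away (homogeneousSubmodule (Fin 3) R) (X 1 * X 2 : MvPolynomial (Fin 3) R)),
      c = awayMap (homogeneousSubmodule (Fin 3) R) (X_two_mem R) (x := X 1 * X 2) rfl v₁ +
        Away.mk _ (X_one_mul_X_two_mem R) 1 (X 2 * X 2) (X_two_sq_mem R) ^ d *
          awayMap (homogeneousSubmodule (Fin 3) R) (X_one_mem R) (x := X 1 * X 2) (mul_comm _ _) v₂ +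
        w * Away.mk _ (X_one_mul_X_two_mem R) d (F * X 2 ^ d) (mul_X_two_pow_mem hF) := by
  classical
  obtain ⟨m, G, hG, rfl⟩ := Away.mk_surjective _ (X_one_mul_X_two_mem R) c
  have hGh : G.IsHomogeneous (m * 2) := by
    have := (mem_homogeneousSubmodule (n := m • 2) G).mp hG
    simpa [smul_eq_mul] using this
  have ha : ∀ s ∈ G.support, monomial s (coeff s G) ∈ homogeneousSubmodule (Fin 3) R (m • 2) := by
    intro s hs
    have hdeg := support_degree_eq hGh s hs
    rw [monomial_eq_C_mul_X_pow]
    exact monomial_mem (by omega) _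
  have eG : Away.mk _ (X_one_mul_X_two_mem R) m G hG =
      Away.mk _ (X_one_mul_X_two_mem R) m (∑ s ∈ G.support, monomial s (coeff s G)) (Submodule.sum_mem _ ha) :=
    away_mk_eq_mk _ _ _ _ _ (by rw [← G.as_sum])
  rw [eG]
  refine split_sum hF G.support _ ha fun s hs => ?_
  have hdeg := support_degree_eq hGh s hs
  have e : Away.mk _ (X_one_mul_X_two_mem R) m (monomial s (coeff s G)) (ha s hs) =
      Away.mk _ (X_one_mul_X_two_mem R) m (C (coeff s G) * X 0 ^ (s 0) * X 1 ^ (s 1) * X 2 ^ (s 2))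
        (monomial_mem (by omega) _) :=
    away_mk_eq_mk _ _ _ _ _ (by rw [monomial_eq_C_mul_X_pow])
  rw [e]
  exact split_monomial hF hu (s 0) (s 1) (s 2) m (coeff s G) (by omega)

end Split

end Plane

end PlaneCurveSplit

end Summit.ResolutionOfSingularities.ResolutionOfSingularities.Cruxes.EquisingularLiftNat.Sections

end
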